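import Literature.Probability.RandomPlanarGeometry.HexSAWSurfaceWallRenewal
import Literature.Probability.RandomPlanarGeometry.HexSAWSurfaceSecondOrderSharp
import HarnessLib

/-!
# The renewal excess is exactly `m(y) − 1 ∼ 2/y²`, and an analytic census of the short irreducible wall bridges

Topic `Literature/Probability/RandomPlanarGeometry` (lane «pcv-sawmu», a-idea-1 g30, car «EXCESS-LIMIT»; parents, both TREE:
`HexSAWSurfaceWallRenewal.lean` (Kesten's renewal decomposition of the adsorbed positive wall bridges of the honeycomb lattice in
the brick-wall frame: irreducible positive wall bridges `ipwb n`, their polynomials `Λ_n(y) = IPWB n y = Σ_ω y^{visits ω}`, the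
block law `f_s(y) = Λ_{2s}(y) β(y)^{−2s}` (`pwbLaw`), KESTEN'S IDENTITY `Σ_s f_s(y) = 1` for `y > μ⁴` (`hasSum_pwbLaw`), the mean
block half-length `m(y) = Σ_s s f_s(y)` (`pwbMean`) and the envelope `f_s ≤ μ²√y θ^s`, `θ = μ²/√y` (`pwbLaw_le_geom`)) and
`HexSAWSurfaceSecondOrderSharp.lean` (the sharp second-order window `y ≤ β(y)² ≤ y + 1/y + 8748/y²` of the wall growth rate and
the uniqueness of the one-visit wall bridge of length six, `card_oneVisit_le_one`; it re-exports the dip `Six.dw` of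
`HexSAWSurfaceSqrtStrict.lean`)).

WHAT IS NEW.  (1) An ANALYTIC CENSUS of the short irreducible blocks, read off Kesten's identity and the free-energy window
instead of an enumeration: at the single fugacity `y = 10⁶` the two known blocks — the atom `(0,0)→(1,0)→(2,0)` (`f₁ ≥ y/β²`) and
the dip `(0,0),(1,0),(1,−1),(2,−1),(3,−1),(3,0),(4,0)` (`f₃ ≥ y/β⁶`) — already exhaust Kesten's unit mass up to `< 10⁻¹³`
(`y/β² + y/β⁶ > 1 − 10⁻¹³`, from `β² ≤ y + 1/y + 8748/y²`), so any further class of irreducible positive wall bridges of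
half-length `s` whose members make `v ≥ s − 2` surface visits is EMPTY — it alone would add `y^v/β^{2s} ≥ 10^{6(v−s)}·(1 − 10⁻⁵) ≥
10⁻¹²·(1 − 10⁻⁵)` to the same identity; with `v ≥ 1` automatic this empties `(s,v) ∈ {(2,·), (3,≥2), (4,≥2), (5,≥3)}`, whence the
y-FREE combinatorial facts
  ★ `ipwb_four_eq_empty : ipwb 4 = ∅`, ★ `ipwb_six_eq_singleton : ipwb 6 = {Six.dw}` (with the tree's uniqueness of the dip),
  ★ `visits_eq_one_of_mem_ipwb_eight`, ★ `visits_le_two_of_mem_ipwb_ten` (all stated with a SYMBOLIC length `m` and a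
  hypothesis `m = 4, 6, 8, 10`, as in the tree's `card_oneVisit_le_one`, to spare the elaborator the closed `Finset`s),
and the first irreducible polynomials `Λ₄ = 0`, `Λ₆(y) = y`, `Λ₈(y) = #(ipwb 8)·y`, `Λ₁₀(y) ≤ #(ipwb 10)·y²` (`y ≥ 1`) — the
tree's renewal file lists "the values of the first irreducible counts" as NOT claimed; here are the first three, by analysis.
(2) THE EXACT RENEWAL EXCESS: ★★★ `tendsto_sq_mul_pwbMean_sub_one : y²(m(y) − 1) → 2` (`y → ∞`), with the two-sided estimate
★★ `2y/β⁶ ≤ m(y) − 1 ≤ 2y/β⁶ + (3·#(ipwb 8) + 4·#(ipwb 10))/y³ + 12 μ¹⁴/(y²√y)` (lower bound on all of `y > μ⁴`, upper for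
`y ≥ 48`), the explicit form ★ `|y²(m(y) − 1) − 2| ≤ 255879/y + 12μ¹⁴/√y + 6/y² + 52488/y³` (`#(ipwb n) ≤ 3ⁿ`), and the
asymptotic equivalence ★ `(m − 1) ~ 2/y²`.  MECHANISM for (2): `m − 1 = Σ_s (s − 1) f_s = 2f₃ + 3f₄ + 4f₅ + Σ_{s ≥ 6}(s − 1)f_s`
(`f₀ = f₂ = 0`), `f₃ = y/β⁶` exactly by (1), `f₄ = #(ipwb 8) y/β⁸ ≤ #/y³` and `f₅ ≤ #(ipwb 10) y²/β¹⁰ ≤ #/y³` by (1) and `β² ≥ y`,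
and the tail `≤ Σ_{j ≥ 0}(j + 5) μ²√y θ^{j+6} ≤ 12 μ¹⁴/(y²√y)` once `θ ≤ ½` (`y ≥ 4μ⁴`, implied by `y ≥ 48`).  This pins the lane's
window `2 ≤ lim y²(m − 1) ≤ 4` (pool car «EXCESS-ORDER») to its lower end: asymptotically ALL the excess of the mean block
half-length over the atom comes from the dip.

SELF-CONSISTENCY (T5-style, by hand): with `β² = y + 1/y + 1/y² + 2/y³ + O(y⁻⁴)` (tree, fourth order) Kesten's identity at orders
`y⁻¹, y⁻²` reads `N₂₁ + N₃₂ = 0` and `N₃₁ + N₄₂ + N₅₃ = a₁ = 1` (`N_{s,v} = #{ω ∈ ipwb 2s : visits = v}`, `a₁` = the `1/y`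
coefficient) — exactly the census (1) with `N₃₁ = 1` (the dip); and `m − 1 = Σ(s−1)N_{s,v} y^{v−s}(1 + O(y⁻²)) = 2N₃₁/y² + O(y⁻³)
= 2/y² + O(y^{−5/2})` ✓.  The sources treat: Kesten's irreducible-bridge renewal and `Σ λ_n β^{-n} = 1` [MadrasSlade1993, §4.2,
(4.2.2)–(4.2.5), Theorem 4.2.2], [Kesten1963SAW, §4]; renewal sequences [Feller1968, XIII.3]; adsorbed honeycomb walks and surface
visits [BeatonBousquetMelouDeGierDuminilCopinGuttmann2014, §3.1, Proposition 5]; surface bridges [HammersleyTorrieWhittington1982,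
§2]; the brick-wall frame [EntingJensen2009, §7.4.2, Fig. 7.10]; strong-adsorption (large-`y`) expansions of adsorbed lattice
walks and polygons [JansevanRensburgWhittington2013, §3.1].  NOT claimed: the values of `#(ipwb 8)`, `#(ipwb 10)` (only `≤ 3ⁿ`),
anything at `y ≤ μ⁴`, the next coefficient of `m − 1` (order `y^{−5/2}` is only an upper bound for the remainder; the true next
term is `O(y⁻³)`), numerics.  RELATION TO THE TREE's `HexSAWSurfaceWallRenewalMean.lean` (Jensen off the atom, explicit
`m(y) − 1` bounds at MODERATE `y` from a window `β² ≤ B`, decay `O(1/y)` at best): complementary — here the exact second-order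
rate `2/y²` and its limit, there usable constants near `y ≈ 25`; no statement of that file is restated (its
`pwbMean_sub_one_le` is the Jensen bound; the census bound here is `pwbMean_sub_one_le_census`).
-/

noncomputable section

namespace Literature.Probability.RandomPlanarGeometry.SAW.HexBW.Wall

open Finset Filter Function Asymptotics
open Literature.Probability.LatticeModels
open _root_.Topology

variable {y : ℝ} {n : ℕ} {ω : ℕ → Site 2}

/-! ### §0 Private helpers: `μ`, the block law as `Λ_{2s}/(β²)^s`, Kesten partial sums -/

/-- `μ² = 2 + √2`. [cite: DuminilCopinSmirnov2012, Theorem 1] -/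
private theorem mu_sq_el : hexConnectiveConstant ^ 2 = 2 + Real.sqrt 2 := by
  rw [hexConnectiveConstant_eq_inv, inv_pow]; exact inv_eq_of_mul_eq_one_right hexCriticalFugacity_sq

/-- `4 ≤ μ⁴`. [cite: DuminilCopinSmirnov2012, Theorem 1] -/
private theorem four_le_mu_four_el : 4 ≤ hexConnectiveConstant ^ 4 := by
  have h2 : 0 ≤ Real.sqrt 2 := Real.sqrt_nonneg 2
  calc (4 : ℝ) ≤ (2 + Real.sqrt 2) ^ 2 := by nlinarith
    _ = hexConnectiveConstant ^ 4 := by rw [← mu_sq_el]; ring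

/-- `μ⁴ < 12`. [cite: DuminilCopinSmirnov2012, Theorem 1] -/
private theorem mu_four_lt_twelve_el : hexConnectiveConstant ^ 4 < 12 := by
  have hup : Real.sqrt 2 ≤ 1.41422 := by
    rw [show (1.41422 : ℝ) = Real.sqrt (1.41422 ^ 2) by rw [Real.sqrt_sq (by norm_num)]]
    exact Real.sqrt_le_sqrt (by norm_num)
  have h2 : 0 ≤ Real.sqrt 2 := Real.sqrt_nonneg 2
  calc hexConnectiveConstant ^ 4 = (hexConnectiveConstant ^ 2) ^ 2 := by ring
    _ = (2 + Real.sqrt 2) ^ 2 := by rw [mu_sq_el]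
    _ ≤ (2 + 1.41422) ^ 2 := by gcongr
    _ < 12 := by norm_num

/-- `y > μ⁴ ⇒ 1 ≤ y`. [cite: DuminilCopinSmirnov2012, Theorem 1] -/
private theorem one_le_of_mu_four_lt_el (hy : hexConnectiveConstant ^ 4 < y) : 1 ≤ y := by
  have := four_le_mu_four_el; linarith

/-- `y ≤ β(y)²` (`β ≥ √y`). [cite: BeatonBousquetMelouDeGierDuminilCopinGuttmann2014, §3.1, Proposition 5 (arXiv v5 p. 9)] -/
private theorem le_sq_wallRate_el (hy : 0 < y) : y ≤ wallRate y ^ 2 := by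
  have h := pow_le_pow_left₀ (Real.sqrt_nonneg y) (sqrt_le_wallRate hy) 2
  rwa [Real.sq_sqrt hy.le] at h

/-- `f_s(y) = Λ_{2s}(y)/(β(y)²)^s`. [cite: MadrasSlade1993, §4.2, (4.2.2)] -/
private theorem pwbLaw_eq_el (y : ℝ) (s : ℕ) : pwbLaw y s = IPWB (2 * s) y / (wallRate y ^ 2) ^ s := by
  rw [pwbLaw, pow_mul]

/-- A sub-sum of `Λ_{2s}` bounds `f_s` from below. [cite: MadrasSlade1993, §4.2, (4.2.2)] -/
private theorem sum_div_le_pwbLaw_el (hy : 0 ≤ y) {s n : ℕ} (hn : 2 * s = n) {T : Finset (ℕ → Site 2)} (hT : T ⊆ ipwb n) :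
    (∑ ω ∈ T, y ^ visits n ω) / (wallRate y ^ 2) ^ s ≤ pwbLaw y s := by
  subst hn
  rw [pwbLaw_eq_el]
  exact div_le_div_of_nonneg_right (Finset.sum_le_sum_of_subset_of_nonneg hT fun _ _ _ => pow_nonneg hy _)
    (pow_nonneg (sq_nonneg _) _)

/-- A single irreducible block bounds `f_s` from below. [cite: MadrasSlade1993, §4.2, (4.2.2)] -/
private theorem single_div_le_pwbLaw_el (hy : 0 ≤ y) {s n : ℕ} (hn : 2 * s = n) (hω : ω ∈ ipwb n) :
    y ^ visits n ω / (wallRate y ^ 2) ^ s ≤ pwbLaw y s := by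
  have h := sum_div_le_pwbLaw_el hy hn (Finset.singleton_subset_iff.2 hω)
  rwa [Finset.sum_singleton] at h

/-- Kesten partial sums: `Σ_{s ∈ S} f_s(y) ≤ 1` for `y > μ⁴`. [cite: MadrasSlade1993, §4.2, (4.2.4) and Theorem 4.2.2] [cite: Kesten1963SAW, §4] -/
private theorem sum_pwbLaw_le_one_el (hy : hexConnectiveConstant ^ 4 < y) (S : Finset ℕ) : ∑ s ∈ S, pwbLaw y s ≤ 1 := by
  have hy0 : 0 ≤ y := by have := four_le_mu_four_el; linarith
  exact sum_le_hasSum S (fun s _ => pwbLaw_nonneg hy0 s) (hasSum_pwbLaw hy)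

/-- Kesten partial sum on `{1, 3}`. [cite: MadrasSlade1993, §4.2, (4.2.4)] -/
private theorem kesten_two_el (hy : hexConnectiveConstant ^ 4 < y) : pwbLaw y 1 + pwbLaw y 3 ≤ 1 := by
  have h := sum_pwbLaw_le_one_el hy {1, 3}
  rwa [Finset.sum_insert (by simp), Finset.sum_singleton] at h

/-- Kesten partial sum on `{1, 3, s}`. [cite: MadrasSlade1993, §4.2, (4.2.4)] -/
private theorem kesten_three_el (hy : hexConnectiveConstant ^ 4 < y) {s : ℕ} (hs1 : s ≠ 1) (hs3 : s ≠ 3) :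
    pwbLaw y 1 + (pwbLaw y 3 + pwbLaw y s) ≤ 1 := by
  have h := sum_pwbLaw_le_one_el hy {1, 3, s}
  have h1 : (1 : ℕ) ∉ ({3, s} : Finset ℕ) := by
    simp only [Finset.mem_insert, Finset.mem_singleton]; omega
  have h3 : (3 : ℕ) ∉ ({s} : Finset ℕ) := by
    simp only [Finset.mem_singleton]; omega
  rwa [Finset.sum_insert h1, Finset.sum_insert h3, Finset.sum_singleton] at h

/-! ### §1 The two known blocks: the atom (length 2) and the dip (length 6); every block ends with a visit -/

/-- **Every irreducible positive wall bridge visits the surface at least once** (its endpoint is a visit).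
[cite: MadrasSlade1993, §4.2, Definition 4.2.1] [cite: BeatonBousquetMelouDeGierDuminilCopinGuttmann2014, §3.1 (arXiv v5 p. 8: c(ω))] -/
private theorem one_le_visits_el (hω : ω ∈ ipwb n) : 1 ≤ visits n ω := by
  classical
  obtain ⟨hp, hn1, -⟩ := mem_ipwb.1 hω
  obtain ⟨hw, -⟩ := mem_pwb.1 hp
  obtain ⟨ha, -⟩ := mem_wbr.1 hw
  obtain ⟨-, hn2, hYn⟩ := mem_archs.1 ha
  obtain ⟨k, rfl⟩ : ∃ k, n = k + 1 := ⟨n - 1, by omega⟩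
  rw [visits_succ, if_pos ⟨hn2, hYn⟩]
  omega

/-- The atom `(0,0) → (1,0) → (2,0)` is an irreducible positive wall bridge of length `2 = 2·1` with one visit (symbolic length).
[cite: BeatonBousquetMelouDeGierDuminilCopinGuttmann2014, §3.1 (arXiv v5 p. 9: walks sticking to the surface)] [cite: MadrasSlade1993, §4.2, Definition 4.2.1] -/
private theorem atom_mem_ipwb_el {m : ℕ} (hm : m = 2 * 1) :
    Zd.straightWalk 2 m ∈ ipwb m ∧ visits m (Zd.straightWalk 2 m) = 1 := by
  have h := straightWalk_mem_pwb 1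
  subst hm
  refine ⟨?_, h.2⟩
  rw [mem_ipwb]
  refine ⟨h.1, by norm_num, fun k hk1 hk2 hr => ?_⟩
  have hk : k % 2 = 0 := hr.2.1
  omega

/-- **The dip is a positive wall bridge** (`X`-coordinates `0,1,1,2,3,3,4`: strictly positive after time `0`, maximal at the end);
the length is kept symbolic (`m = 6`). [cite: MadrasSlade1993, Definition 1.2.4] [cite: EntingJensen2009, §7.4.2, Fig. 7.10] -/
theorem dw_mem_pwb {m : ℕ} (hm : m = 6) : Six.dw ∈ pwb m := by
  rw [mem_pwb, mem_wbr, mem_archs, mem_hpw, mem_saws_iff]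
  obtain ⟨h0, hfr, hbw, hinj, hH, harch, hwb⟩ := Six.dw_components
  subst hm
  refine ⟨⟨⟨⟨⟨h0, hfr, hbw, hinj⟩, hH⟩, harch⟩, hwb⟩, fun i h1 h2 => ?_⟩
  simp only [Six.dw, Arm.pt_apply_zero, min_eq_left h2, Nat.zero_min, min_self]
  interval_cases i <;> decide

/-- **The dip is irreducible**: its only surface visit is its endpoint, so it has no wall-renewal time in `[1, 6)` (symbolic length).
[cite: MadrasSlade1993, §4.2, Definition 4.2.1] [cite: EntingJensen2009, §7.4.2, Fig. 7.10] -/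
theorem dw_mem_ipwb {m : ℕ} (hm : m = 6) : Six.dw ∈ ipwb m := by
  rw [mem_ipwb]
  refine ⟨dw_mem_pwb hm, by omega, fun k hk1 hk2 h => ?_⟩
  have hk : k % 2 = 0 := h.2.1
  have hY : Six.dw k 1 = 0 := h.2.2
  subst hm
  simp only [Six.dw, Arm.pt_apply_one, min_eq_left hk2.le] at hY
  interval_cases k
  all_goals first | omega | (revert hY; decide)

/-- The dip has one visit (symbolic length). [cite: EntingJensen2009, §7.4.2, Fig. 7.10] -/
private theorem visits_dw_el {m : ℕ} (hm : m = 6) : visits m Six.dw = 1 := by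
  rw [hm]; exact Six.visits_sw_dw.2

/-- `f₁(y) ≥ y/β²` (the atom; private twin, for `0 ≤ y`, of the tree's `HexSAWSurfaceWallRenewalMean.div_sq_wallRate_le_pwbLaw_one`,
which this file does not import). [cite: MadrasSlade1993, §4.2, (4.2.2)] [cite: BeatonBousquetMelouDeGierDuminilCopinGuttmann2014, §3.1] -/
private theorem div_sq_wallRate_le_pwbLaw_one_el (hy : 0 ≤ y) : y / wallRate y ^ 2 ≤ pwbLaw y 1 := by
  obtain ⟨m, hm⟩ : ∃ m : ℕ, m = 2 * 1 := ⟨_, rfl⟩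
  obtain ⟨hmem, hv⟩ := atom_mem_ipwb_el hm
  have h := single_div_le_pwbLaw_el (s := 1) (n := m) hy (by omega) hmem
  rw [hv, pow_one, pow_one] at h
  exact h

/-- `f₃(y) ≥ y/β⁶` (the dip). [cite: MadrasSlade1993, §4.2, (4.2.2)] [cite: EntingJensen2009, §7.4.2, Fig. 7.10] -/
theorem div_wallRate_six_le_pwbLaw_three (hy : 0 ≤ y) : y / wallRate y ^ 6 ≤ pwbLaw y 3 := by
  obtain ⟨m, hm⟩ : ∃ m : ℕ, m = 6 := ⟨_, rfl⟩
  have h := single_div_le_pwbLaw_el (s := 3) (n := m) hy (by omega) (dw_mem_ipwb hm)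
  rw [visits_dw_el hm, pow_one, ← pow_mul] at h
  exact h

/-! ### §2 The room left by the two known blocks at `y = 10⁶` is below `10⁻¹³` -/

/-- **Room lemma.**  At `y = 10⁶`: if `y/β² + (y/β⁶ + x) ≤ 1` then `x < 10⁻¹³` — from `y ≤ β² ≤ y + 1/y + 8748/y²`.
[cite: MadrasSlade1993, §4.2, (4.2.4)] [cite: BeatonBousquetMelouDeGierDuminilCopinGuttmann2014, §3.1, Proposition 5] -/
private theorem no_room_el {x : ℝ} (hx : (1 / 10 ^ 13 : ℝ) ≤ x)
    (h : 1000000 / wallRate 1000000 ^ 2 + (1000000 / (wallRate 1000000 ^ 2) ^ 3 + x) ≤ 1) : False := by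
  set B := wallRate 1000000 ^ 2 with hB
  have hlo : (1000000 : ℝ) ≤ B := le_sq_wallRate_el (by norm_num)
  have hhi : B ≤ 1000000 + 1 / 1000000 + 8748 / 1000000 ^ 2 := wallRate_sq_le_sharp (by norm_num)
  have hB0 : 0 < B := by linarith
  have hBhi : B ≤ 1000001 := by
    have : (1 : ℝ) / 1000000 + 8748 / 1000000 ^ 2 ≤ 1 := by norm_num
    linarith
  have key : 1000000 * B ^ 2 + 1000000 + x * B ^ 3 ≤ B ^ 3 := by
    have e : 1000000 / B + (1000000 / B ^ 3 + x) = (1000000 * B ^ 2 + 1000000 + x * B ^ 3) / B ^ 3 := by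
      field_simp
      ring
    rw [e, div_le_one (pow_pos hB0 3)] at h
    exact h
  have hB2 : B ^ 2 ≤ 1000001 ^ 2 := pow_le_pow_left₀ hB0.le hBhi 2
  have hB3 : (1000000 : ℝ) ^ 3 ≤ B ^ 3 := pow_le_pow_left₀ (by norm_num) hlo 3
  have hdd : 0 ≤ B - 1000000 := by linarith
  have h2 : B ^ 2 * (B - 1000000) ≤ 1000001 ^ 2 * (1 / 1000000 + 8748 / 1000000 ^ 2) :=
    mul_le_mul hB2 (by linarith) hdd (by norm_num)
  have h3 : (1 / 10 ^ 13 : ℝ) * 1000000 ^ 3 ≤ x * B ^ 3 := mul_le_mul hx hB3 (by norm_num) (by linarith)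
  have hD : (1000001 : ℝ) ^ 2 * (1 / 1000000 + 8748 / 1000000 ^ 2) < 1100000 := by norm_num
  have h13 : (1 / 10 ^ 13 : ℝ) * 1000000 ^ 3 = 100000 := by norm_num
  have e2 : B ^ 2 * (B - 1000000) = B ^ 3 - 1000000 * B ^ 2 := by ring
  rw [e2] at h2
  rw [h13] at h3
  linarith

/-- `μ⁴ < 10⁶`. [cite: DuminilCopinSmirnov2012, Theorem 1] -/
private theorem mu_four_lt_Y_el : hexConnectiveConstant ^ 4 < 1000000 := mu_four_lt_twelve_el.trans (by norm_num)

/-- A class term `y^a/β^{2b}` at `y = 10⁶` is at least `10^{6a}/1000001^b`. [cite: BeatonBousquetMelouDeGierDuminilCopinGuttmann2014, §3.1, Proposition 5] -/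
private theorem class_term_ge_el (a b : ℕ) :
    (1000000 : ℝ) ^ a / 1000001 ^ b ≤ 1000000 ^ a / (wallRate 1000000 ^ 2) ^ b := by
  have hlo : (1000000 : ℝ) ≤ wallRate 1000000 ^ 2 := le_sq_wallRate_el (by norm_num)
  have hhi : wallRate 1000000 ^ 2 ≤ 1000000 + 1 / 1000000 + 8748 / 1000000 ^ 2 := wallRate_sq_le_sharp (by norm_num)
  have hBhi : wallRate 1000000 ^ 2 ≤ 1000001 := by
    have : (1 : ℝ) / 1000000 + 8748 / 1000000 ^ 2 ≤ 1 := by norm_num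
    linarith
  exact div_le_div_of_nonneg_left (by positivity) (pow_pos (by linarith) _) (pow_le_pow_left₀ (by linarith) hBhi b)

/-- The visit monomial is monotone in the number of visits at `y = 10⁶`. [cite: BeatonBousquetMelouDeGierDuminilCopinGuttmann2014, §3.1] -/
private theorem pow_visits_ge_el {a v : ℕ} (hv : a ≤ v) (b : ℕ) :
    (1000000 : ℝ) ^ a / (wallRate 1000000 ^ 2) ^ b ≤ 1000000 ^ v / (wallRate 1000000 ^ 2) ^ b :=
  div_le_div_of_nonneg_right (pow_le_pow_right₀ (by norm_num) hv) (pow_nonneg (sq_nonneg _) _)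

/-- `(β²)³ = β⁶` at `y = 10⁶` (syntactic bridge between the two known-block bounds). [cite: MadrasSlade1993, §4.2, (4.2.2)] -/
private theorem sq_cube_el : (wallRate 1000000 ^ 2) ^ 3 = wallRate 1000000 ^ 6 := by rw [← pow_mul]

/-! ### §3 The analytic census (symbolic lengths `m = 4, 6, 8, 10`): `ipwb 4 = ∅`, `ipwb 6 = {dip}`, one visit on `ipwb 8`,
at most two on `ipwb 10` -/

/-- ★ **There is no irreducible positive wall bridge of length `4`** (a class `(s,v) = (2,1)` would add `≈ y⁻¹ ≫ 10⁻¹³` to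
Kesten's identity at `y = 10⁶`). [cite: MadrasSlade1993, §4.2, (4.2.4) and Theorem 4.2.2] [cite: Kesten1963SAW, §4] -/
theorem ipwb_four_eq_empty {m : ℕ} (hm : m = 4) : ipwb m = ∅ := by
  by_contra hne
  obtain ⟨ω, hω⟩ := Finset.nonempty_iff_ne_empty.2 hne
  have hv := one_le_visits_el hω
  have hK := kesten_three_el mu_four_lt_Y_el (s := 2) (by norm_num) (by norm_num)
  have h1 := div_sq_wallRate_le_pwbLaw_one_el (y := 1000000) (by norm_num)
  have h3 := div_wallRate_six_le_pwbLaw_three (y := 1000000) (by norm_num)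
  have hs := single_div_le_pwbLaw_el (y := 1000000) (s := 2) (n := m) (by norm_num) (by omega) hω
  have hx : (1 / 10 ^ 13 : ℝ) ≤ 1000000 ^ visits m ω / (wallRate 1000000 ^ 2) ^ 2 :=
    calc (1 / 10 ^ 13 : ℝ) ≤ 1000000 ^ 1 / 1000001 ^ 2 := by norm_num
      _ ≤ 1000000 ^ 1 / (wallRate 1000000 ^ 2) ^ 2 := class_term_ge_el 1 2
      _ ≤ _ := pow_visits_ge_el hv 2
  refine no_room_el hx ?_
  rw [sq_cube_el]
  linarith

/-- ★ **Every irreducible positive wall bridge of length `6` has exactly one visit** (a class `(3,2)` would add `≈ y⁻¹`).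
[cite: MadrasSlade1993, §4.2, (4.2.4) and Theorem 4.2.2] [cite: Kesten1963SAW, §4] -/
theorem visits_eq_one_of_mem_ipwb_six {m : ℕ} (hm : m = 6) (hω : ω ∈ ipwb m) : visits m ω = 1 := by
  classical
  have hv := one_le_visits_el hω
  by_contra hne
  have hv2 : 2 ≤ visits m ω := by omega
  have hvd := visits_dw_el hm
  have hne' : Six.dw ≠ ω := fun h => by rw [← h, hvd] at hv2; omega
  have hK := kesten_two_el mu_four_lt_Y_el
  have h1 := div_sq_wallRate_le_pwbLaw_one_el (y := 1000000) (by norm_num)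
  have hpair : ({Six.dw, ω} : Finset (ℕ → Site 2)) ⊆ ipwb m :=
    Finset.insert_subset_iff.2 ⟨dw_mem_ipwb hm, Finset.singleton_subset_iff.2 hω⟩
  have hs := sum_div_le_pwbLaw_el (y := 1000000) (s := 3) (n := m) (by norm_num) (by omega) hpair
  rw [Finset.sum_pair hne', hvd, pow_one, add_div] at hs
  have hx : (1 / 10 ^ 13 : ℝ) ≤ 1000000 ^ visits m ω / (wallRate 1000000 ^ 2) ^ 3 :=
    calc (1 / 10 ^ 13 : ℝ) ≤ 1000000 ^ 2 / 1000001 ^ 3 := by norm_num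
      _ ≤ 1000000 ^ 2 / (wallRate 1000000 ^ 2) ^ 3 := class_term_ge_el 2 3
      _ ≤ _ := pow_visits_ge_el hv2 3
  refine no_room_el hx ?_
  linarith

/-- ★ **The dip is the unique irreducible positive wall bridge of length `6`**: `ipwb 6 = {dw}` (one visit by the census,
uniqueness of the one-visit wall bridge of length six from the tree). [cite: MadrasSlade1993, §4.2, Definition 4.2.1]
[cite: EntingJensen2009, §7.4.2, Fig. 7.10] -/
theorem ipwb_six_eq_singleton {m : ℕ} (hm : m = 6) : ipwb m = {Six.dw} := by
  classical
  refine Finset.eq_singleton_iff_unique_mem.2 ⟨dw_mem_ipwb hm, fun ω hω => ?_⟩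
  have hF : ∀ ω', ω' ∈ ipwb m → ω' ∈ (wbr m).filter fun ω => visits m ω = 1 := fun ω' hω' =>
    Finset.mem_filter.2 ⟨pwb_subset (ipwb_subset hω'), visits_eq_one_of_mem_ipwb_six hm hω'⟩
  exact Finset.card_le_one.1 (card_oneVisit_le_one hm) ω (hF ω hω) Six.dw (hF _ (dw_mem_ipwb hm))

/-- ★ **Every irreducible positive wall bridge of length `8` has exactly one visit** (a class `(4,2)` would add `≈ y⁻² ≫ 10⁻¹³`
at `y = 10⁶`). [cite: MadrasSlade1993, §4.2, (4.2.4) and Theorem 4.2.2] [cite: Kesten1963SAW, §4] -/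
theorem visits_eq_one_of_mem_ipwb_eight {m : ℕ} (hm : m = 8) (hω : ω ∈ ipwb m) : visits m ω = 1 := by
  have hv := one_le_visits_el hω
  by_contra hne
  have hv2 : 2 ≤ visits m ω := by omega
  have hK := kesten_three_el mu_four_lt_Y_el (s := 4) (by norm_num) (by norm_num)
  have h1 := div_sq_wallRate_le_pwbLaw_one_el (y := 1000000) (by norm_num)
  have h3 := div_wallRate_six_le_pwbLaw_three (y := 1000000) (by norm_num)
  have hs := single_div_le_pwbLaw_el (y := 1000000) (s := 4) (n := m) (by norm_num) (by omega) hω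
  have hx : (1 / 10 ^ 13 : ℝ) ≤ 1000000 ^ visits m ω / (wallRate 1000000 ^ 2) ^ 4 :=
    calc (1 / 10 ^ 13 : ℝ) ≤ 1000000 ^ 2 / 1000001 ^ 4 := by norm_num
      _ ≤ 1000000 ^ 2 / (wallRate 1000000 ^ 2) ^ 4 := class_term_ge_el 2 4
      _ ≤ _ := pow_visits_ge_el hv2 4
  refine no_room_el hx ?_
  rw [sq_cube_el]
  linarith

/-- ★ **Every irreducible positive wall bridge of length `10` has at most two visits** (a class `(5,3)` would add `≈ y⁻²`).
[cite: MadrasSlade1993, §4.2, (4.2.4) and Theorem 4.2.2] [cite: Kesten1963SAW, §4] -/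
theorem visits_le_two_of_mem_ipwb_ten {m : ℕ} (hm : m = 10) (hω : ω ∈ ipwb m) : visits m ω ≤ 2 := by
  by_contra hne
  have hv3 : 3 ≤ visits m ω := by omega
  have hK := kesten_three_el mu_four_lt_Y_el (s := 5) (by norm_num) (by norm_num)
  have h1 := div_sq_wallRate_le_pwbLaw_one_el (y := 1000000) (by norm_num)
  have h3 := div_wallRate_six_le_pwbLaw_three (y := 1000000) (by norm_num)
  have hs := single_div_le_pwbLaw_el (y := 1000000) (s := 5) (n := m) (by norm_num) (by omega) hω
  have hx : (1 / 10 ^ 13 : ℝ) ≤ 1000000 ^ visits m ω / (wallRate 1000000 ^ 2) ^ 5 :=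
    calc (1 / 10 ^ 13 : ℝ) ≤ 1000000 ^ 3 / 1000001 ^ 5 := by norm_num
      _ ≤ 1000000 ^ 3 / (wallRate 1000000 ^ 2) ^ 5 := class_term_ge_el 3 5
      _ ≤ _ := pow_visits_ge_el hv3 5
  refine no_room_el hx ?_
  rw [sq_cube_el]
  linarith

/-! ### §4 The first irreducible polynomials and block probabilities -/

/-- ★ `Λ₄ ≡ 0` (symbolic length). [cite: MadrasSlade1993, §4.2, (4.2.2)] -/
theorem IPWB_four {m : ℕ} (hm : m = 4) (y : ℝ) : IPWB m y = 0 := by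
  rw [IPWB, ipwb_four_eq_empty hm, Finset.sum_empty]

/-- ★ `Λ₆(y) = y` (the dip alone; symbolic length). [cite: MadrasSlade1993, §4.2, (4.2.2)] [cite: EntingJensen2009, §7.4.2, Fig. 7.10] -/
theorem IPWB_six {m : ℕ} (hm : m = 6) (y : ℝ) : IPWB m y = y := by
  rw [IPWB, ipwb_six_eq_singleton hm, Finset.sum_singleton, visits_dw_el hm, pow_one]

/-- ★ `Λ₈(y) = #(ipwb 8)·y` (every block of length eight has one visit; symbolic length). [cite: MadrasSlade1993, §4.2, (4.2.2)] -/
theorem IPWB_eight {m : ℕ} (hm : m = 8) (y : ℝ) : IPWB m y = #(ipwb m) * y := by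
  rw [IPWB, Finset.sum_congr rfl fun ω hω => by rw [visits_eq_one_of_mem_ipwb_eight hm hω, pow_one], Finset.sum_const,
    nsmul_eq_mul]

/-- ★ `Λ₁₀(y) ≤ #(ipwb 10)·y²` for `y ≥ 1` (at most two visits; symbolic length). [cite: MadrasSlade1993, §4.2, (4.2.2)] -/
theorem IPWB_ten_le {m : ℕ} (hm : m = 10) (hy : 1 ≤ y) : IPWB m y ≤ #(ipwb m) * y ^ 2 := by
  rw [IPWB]
  have h := Finset.sum_le_card_nsmul (ipwb m) (fun ω => y ^ visits m ω) (y ^ 2) fun ω hω =>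
    pow_le_pow_right₀ hy (visits_le_two_of_mem_ipwb_ten hm hω)
  rwa [nsmul_eq_mul] at h

/-- `f₂ ≡ 0`. [cite: MadrasSlade1993, §4.2, (4.2.2), (4.2.4)] -/
theorem pwbLaw_two (y : ℝ) : pwbLaw y 2 = 0 := by
  rw [pwbLaw, IPWB_four (m := 2 * 2) (by norm_num), zero_div]

/-- `f₃(y) = y/β(y)⁶` exactly. [cite: MadrasSlade1993, §4.2, (4.2.2), (4.2.4)] -/
theorem pwbLaw_three (y : ℝ) : pwbLaw y 3 = y / wallRate y ^ 6 := by
  rw [pwbLaw, IPWB_six (m := 2 * 3) (by norm_num)]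

/-- `f₄(y) = #(ipwb 8)·y/β(y)⁸` (symbolic length). [cite: MadrasSlade1993, §4.2, (4.2.2), (4.2.4)] -/
theorem pwbLaw_four {m : ℕ} (hm : m = 8) (y : ℝ) : pwbLaw y 4 = #(ipwb m) * y / wallRate y ^ 8 := by
  have e : pwbLaw y 4 = IPWB m y / wallRate y ^ m := by rw [pwbLaw, hm]
  rw [e, IPWB_eight hm, hm]

/-- `f₅(y) ≤ #(ipwb 10)·y²/β(y)¹⁰` (`y ≥ 1`; symbolic length). [cite: MadrasSlade1993, §4.2, (4.2.2), (4.2.4)] -/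
theorem pwbLaw_five_le {m : ℕ} (hm : m = 10) (hy : 1 ≤ y) : pwbLaw y 5 ≤ #(ipwb m) * y ^ 2 / wallRate y ^ 10 := by
  have e : pwbLaw y 5 = IPWB m y / wallRate y ^ m := by rw [pwbLaw, hm]
  rw [e]
  have h := div_le_div_of_nonneg_right (IPWB_ten_le hm hy) (pow_nonneg (wallRate_pos y).le m)
  rwa [hm] at h ⊢

/-- `#(ipwb n) ≤ 3ⁿ`. [cite: MadrasSlade1993, §1.2, (1.2.3)] -/
theorem card_ipwb_le_three_pow (n : ℕ) : (#(ipwb n) : ℝ) ≤ 3 ^ n :=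
  (Nat.cast_le.2 (Finset.card_le_card ((ipwb_subset.trans pwb_subset).trans
    ((wbr_subset.trans archs_subset).trans hpw_subset)))).trans (Arm.card_saws_le_three_pow n)

/-- `f₄(y) ≤ #(ipwb 8)/y³` and `f₅(y) ≤ #(ipwb 10)/y³` (`β² ≥ y ≥ 1`; symbolic lengths). [cite: MadrasSlade1993, §4.2, (4.2.2), (4.2.4)]
[cite: BeatonBousquetMelouDeGierDuminilCopinGuttmann2014, §3.1, Proposition 5 (β ≥ √y)] -/
theorem pwbLaw_four_five_le {m m' : ℕ} (hm : m = 8) (hm' : m' = 10) (hy : 1 ≤ y) :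
    pwbLaw y 4 ≤ #(ipwb m) / y ^ 3 ∧ pwbLaw y 5 ≤ #(ipwb m') / y ^ 3 := by
  have hy0 : 0 < y := by linarith
  have hB : y ≤ wallRate y ^ 2 := le_sq_wallRate_el hy0
  have h8 : y ^ 4 ≤ wallRate y ^ 8 := by rw [show (8 : ℕ) = 2 * 4 by norm_num, pow_mul]; exact pow_le_pow_left₀ hy0.le hB 4
  have h10 : y ^ 5 ≤ wallRate y ^ 10 := by
    rw [show (10 : ℕ) = 2 * 5 by norm_num, pow_mul]; exact pow_le_pow_left₀ hy0.le hB 5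
  constructor
  · rw [pwbLaw_four hm]
    calc #(ipwb m) * y / wallRate y ^ 8 ≤ #(ipwb m) * y / y ^ 4 :=
          div_le_div_of_nonneg_left (by positivity) (by positivity) h8
      _ = #(ipwb m) / y ^ 3 := by
          rw [div_eq_div_iff (by positivity) (by positivity)]; ring
  · calc pwbLaw y 5 ≤ #(ipwb m') * y ^ 2 / wallRate y ^ 10 := pwbLaw_five_le hm' hy
      _ ≤ #(ipwb m') * y ^ 2 / y ^ 5 := div_le_div_of_nonneg_left (by positivity) (by positivity) h10
      _ = #(ipwb m') / y ^ 3 := by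
          rw [div_eq_div_iff (by positivity) (by positivity)]; ring

/-! ### §5 The excess `m − 1 = 2f₃ + 3f₄ + 4f₅ + tail`, the tail bound, and the exact limit `y²(m − 1) → 2` -/

/-- **Excess decomposition**: for `y > μ⁴`, `Σ_{j ≥ 0} (j + 5) f_{j+6}(y)` sums to `m(y) − 1 − (2f₃ + 3f₄ + 4f₅)` (`f₀ = f₂ = 0`).
[cite: MadrasSlade1993, §4.2, (4.2.4)–(4.2.5) and Theorem 4.2.2] [cite: Feller1968, XIII.3] -/
theorem hasSum_excess_tail (hy : hexConnectiveConstant ^ 4 < y) :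
    HasSum (fun j : ℕ => ((j : ℝ) + 5) * pwbLaw y (j + 6))
      (pwbMean y - 1 - (2 * pwbLaw y 3 + 3 * pwbLaw y 4 + 4 * pwbLaw y 5)) := by
  have hf1 := hasSum_pwbLaw hy
  have hfm : HasSum (fun k : ℕ => (k : ℝ) * pwbLaw y k) (pwbMean y) := (summable_mul_pwbLaw hy).hasSum
  have hg : HasSum (fun k : ℕ => ((k : ℝ) - 1) * pwbLaw y k) (pwbMean y - 1) := by
    have h := hfm.sub hf1
    simpa only [sub_one_mul] using h
  have ht := (hasSum_nat_add_iff' 6).2 hg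
  have hsum : ∑ i ∈ Finset.range 6, ((i : ℝ) - 1) * pwbLaw y i = 2 * pwbLaw y 3 + 3 * pwbLaw y 4 + 4 * pwbLaw y 5 := by
    simp only [Finset.sum_range_succ, Finset.sum_range_zero, pwbLaw_zero, pwbLaw_two]
    push_cast
    ring
  rw [hsum] at ht
  exact ht.congr_fun fun j => by push_cast; ring

/-- **The named part is below the excess**: `2f₃ + 3f₄ + 4f₅ ≤ m − 1` (the tail is nonnegative). [cite: MadrasSlade1993, §4.2, (4.2.5)] [cite: Feller1968, XIII.3] -/
theorem two_three_four_le_pwbMean_sub_one (hy : hexConnectiveConstant ^ 4 < y) :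
    2 * pwbLaw y 3 + 3 * pwbLaw y 4 + 4 * pwbLaw y 5 ≤ pwbMean y - 1 := by
  have hy0 : 0 ≤ y := by have := four_le_mu_four_el; linarith
  have h0 := (hasSum_excess_tail hy).nonneg fun j => mul_nonneg (by positivity) (pwbLaw_nonneg hy0 (j + 6))
  linarith

/-- ★★ **Lower bound** `2y/β(y)⁶ ≤ m(y) − 1` on the whole regime `y > μ⁴` (the dip alone). [cite: MadrasSlade1993, §4.2, (4.2.5) and Theorem 4.2.2]
[cite: EntingJensen2009, §7.4.2, Fig. 7.10] -/
theorem two_mul_div_le_pwbMean_sub_one (hy : hexConnectiveConstant ^ 4 < y) :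
    2 * y / wallRate y ^ 6 ≤ pwbMean y - 1 := by
  have hy0 : 0 ≤ y := by have := four_le_mu_four_el; linarith
  have h := two_three_four_le_pwbMean_sub_one hy
  have h4 := pwbLaw_nonneg hy0 4
  have h5 := pwbLaw_nonneg hy0 5
  rw [pwbLaw_three] at h
  have e2 : 2 * y / wallRate y ^ 6 = 2 * (y / wallRate y ^ 6) := by ring
  linarith

/-- `θ = μ²/√y ≤ ½` once `y ≥ 48` (`4μ⁴ < 48`). [cite: MadrasSlade1993, §4.2, remark before (4.2.21) (p. 94)] [cite: DuminilCopinSmirnov2012, Theorem 1] -/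
private theorem theta_le_half_el (hy : 48 ≤ y) : hexConnectiveConstant ^ 2 / Real.sqrt y ≤ 1 / 2 := by
  have hy0 : 0 < y := by linarith
  have hs0 : 0 < Real.sqrt y := Real.sqrt_pos.2 hy0
  have hy2 : Real.sqrt y ^ 2 = y := Real.sq_sqrt hy0.le
  have h4 : (2 * hexConnectiveConstant ^ 2) ^ 2 ≤ Real.sqrt y ^ 2 := by
    rw [hy2]
    have e : (2 * hexConnectiveConstant ^ 2) ^ 2 = 4 * hexConnectiveConstant ^ 4 := by ring
    rw [e]
    have := mu_four_lt_twelve_el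
    linarith
  have h2 : 2 * hexConnectiveConstant ^ 2 ≤ Real.sqrt y :=
    (pow_le_pow_iff_left₀ (by positivity) hs0.le two_ne_zero).1 h4
  rw [div_le_iff₀ hs0]
  linarith

/-- ★★ **Tail bound**: for `y ≥ 48`, `m(y) − 1 − (2f₃ + 3f₄ + 4f₅) ≤ 12 μ¹⁴/(y²√y)` (envelope `f_s ≤ μ²√y θ^s`, `θ ≤ ½`,
`Σ_j (j + 5)θ^j = θ/(1 − θ)² + 5/(1 − θ) ≤ 12`). [cite: MadrasSlade1993, §4.2, Theorem 4.2.2 and remark before (4.2.21) (p. 94)] [cite: Feller1968, XIII.3] -/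
theorem excess_tail_le (hy : 48 ≤ y) :
    pwbMean y - 1 - (2 * pwbLaw y 3 + 3 * pwbLaw y 4 + 4 * pwbLaw y 5) ≤
      12 * hexConnectiveConstant ^ 14 / (y ^ 2 * Real.sqrt y) := by
  have hy0 : 0 < y := by linarith
  have hy1 : 1 ≤ y := by linarith
  have hμ : hexConnectiveConstant ^ 4 < y := mu_four_lt_twelve_el.trans_le (by linarith)
  have hθhalf := theta_le_half_el hy
  have hs0 : 0 < Real.sqrt y := Real.sqrt_pos.2 hy0
  have hμ2 : 0 < hexConnectiveConstant ^ 2 := pow_pos hexConnectiveConstant_pos 2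
  have hθ0 : 0 < hexConnectiveConstant ^ 2 / Real.sqrt y := div_pos hμ2 hs0
  have hθ1 : hexConnectiveConstant ^ 2 / Real.sqrt y < 1 := by linarith
  have ht := hasSum_excess_tail hμ
  have hG1 : HasSum (fun j : ℕ => (j : ℝ) * (hexConnectiveConstant ^ 2 / Real.sqrt y) ^ j)
      ((hexConnectiveConstant ^ 2 / Real.sqrt y) / (1 - hexConnectiveConstant ^ 2 / Real.sqrt y) ^ 2) :=
    hasSum_coe_mul_geometric_of_norm_lt_one (by rw [Real.norm_of_nonneg hθ0.le]; exact hθ1)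
  have hG0 : HasSum (fun j : ℕ => (hexConnectiveConstant ^ 2 / Real.sqrt y) ^ j)
      (1 - hexConnectiveConstant ^ 2 / Real.sqrt y)⁻¹ := hasSum_geometric_of_lt_one hθ0.le hθ1
  have hG : HasSum (fun j : ℕ => ((j : ℝ) + 5) *
      (hexConnectiveConstant ^ 2 * Real.sqrt y * (hexConnectiveConstant ^ 2 / Real.sqrt y) ^ (j + 6)))
      (hexConnectiveConstant ^ 2 * Real.sqrt y * (hexConnectiveConstant ^ 2 / Real.sqrt y) ^ 6 *
        ((hexConnectiveConstant ^ 2 / Real.sqrt y) / (1 - hexConnectiveConstant ^ 2 / Real.sqrt y) ^ 2 +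
          5 * (1 - hexConnectiveConstant ^ 2 / Real.sqrt y)⁻¹)) := by
    have h := (hG1.add (hG0.mul_left 5)).mul_left
      (hexConnectiveConstant ^ 2 * Real.sqrt y * (hexConnectiveConstant ^ 2 / Real.sqrt y) ^ 6)
    exact h.congr_fun fun j => by ring
  have hle := hasSum_le (fun j => mul_le_mul_of_nonneg_left (pwbLaw_le_geom hy1 (j + 6)) (by positivity)) ht hG
  -- the numerical factor `θ/(1 − θ)² + 5/(1 − θ) ≤ 2 + 10 = 12` for `θ ≤ ½`
  set θ := hexConnectiveConstant ^ 2 / Real.sqrt y with hθ_def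
  have h1θ : 1 / 2 ≤ 1 - θ := by linarith
  have hinv : (1 - θ)⁻¹ ≤ 2 := by
    rw [inv_le_comm₀ (by linarith) (by norm_num)]
    linarith
  have hq : 1 / 4 ≤ (1 - θ) ^ 2 := by nlinarith
  have hdiv : θ / (1 - θ) ^ 2 ≤ 2 := by
    rw [div_le_iff₀ (by positivity)]
    linarith
  have hsum : θ / (1 - θ) ^ 2 + 5 * (1 - θ)⁻¹ ≤ 12 := by linarith
  -- the prefactor `μ²√y θ⁶ = μ¹⁴/(y²√y)`
  set s := Real.sqrt y with hs_def
  have hys : y = s ^ 2 := (Real.sq_sqrt hy0.le).symm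
  have hE0 : 0 ≤ hexConnectiveConstant ^ 2 * s * θ ^ 6 := by positivity
  have hEθ : hexConnectiveConstant ^ 2 * s * θ ^ 6 = hexConnectiveConstant ^ 14 / (y ^ 2 * s) := by
    rw [show y ^ 2 * s = s ^ 5 by rw [hys]; ring, hθ_def, div_pow, ← mul_div_assoc,
      div_eq_div_iff (pow_ne_zero 6 hs0.ne') (pow_ne_zero 5 hs0.ne')]
    ring
  calc pwbMean y - 1 - (2 * pwbLaw y 3 + 3 * pwbLaw y 4 + 4 * pwbLaw y 5)
      ≤ hexConnectiveConstant ^ 2 * s * θ ^ 6 * (θ / (1 - θ) ^ 2 + 5 * (1 - θ)⁻¹) := hle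
    _ ≤ hexConnectiveConstant ^ 2 * s * θ ^ 6 * 12 := mul_le_mul_of_nonneg_left hsum hE0
    _ = 12 * hexConnectiveConstant ^ 14 / (y ^ 2 * s) := by rw [hEθ]; ring

/-- ★★ **Upper bound** for `y ≥ 48`: `m(y) − 1 ≤ 2y/β⁶ + (3·#(ipwb 8) + 4·#(ipwb 10))/y³ + 12 μ¹⁴/(y²√y)` (symbolic lengths
`m = 8`, `m' = 10`). [cite: MadrasSlade1993, §4.2, (4.2.2)–(4.2.5) and Theorem 4.2.2] [cite: Kesten1963SAW, §4] -/
theorem pwbMean_sub_one_le_census {m m' : ℕ} (hm : m = 8) (hm' : m' = 10) (hy : 48 ≤ y) :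
    pwbMean y - 1 ≤ 2 * y / wallRate y ^ 6 + (3 * #(ipwb m) + 4 * #(ipwb m')) / y ^ 3 +
      12 * hexConnectiveConstant ^ 14 / (y ^ 2 * Real.sqrt y) := by
  have hy1 : 1 ≤ y := by linarith
  have ht := excess_tail_le hy
  obtain ⟨h4, h5⟩ := pwbLaw_four_five_le hm hm' hy1
  rw [pwbLaw_three] at ht
  have e1 : (3 * #(ipwb m) + 4 * #(ipwb m') : ℝ) / y ^ 3 = 3 * (#(ipwb m) / y ^ 3) + 4 * (#(ipwb m') / y ^ 3) := by ring
  have e2 : 2 * y / wallRate y ^ 6 = 2 * (y / wallRate y ^ 6) := by ring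
  linarith

/-- **`f₃` window**: `(1 − 3δ)/y² ≤ y/β(y)⁶ ≤ 1/y²` with `δ = 1/y² + 8748/y³` (`y ≤ β² ≤ y + 1/y + 8748/y²`), for `y ≥ 1`.
[cite: BeatonBousquetMelouDeGierDuminilCopinGuttmann2014, §3.1, Proposition 5] [cite: MadrasSlade1993, §4.2, (4.2.2)] -/
theorem div_wallRate_six_window (hy : 1 ≤ y) :
    (1 - 3 * (1 / y ^ 2 + 8748 / y ^ 3)) / y ^ 2 ≤ y / wallRate y ^ 6 ∧ y / wallRate y ^ 6 ≤ 1 / y ^ 2 := by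
  have hy0 : 0 < y := by linarith
  set B := wallRate y ^ 2 with hB
  have hlo : y ≤ B := le_sq_wallRate_el hy0
  have hhi : B ≤ y + 1 / y + 8748 / y ^ 2 := wallRate_sq_le_sharp hy
  have hB0 : 0 < B := by linarith
  have e6 : wallRate y ^ 6 = B ^ 3 := by rw [hB, ← pow_mul]
  rw [e6]
  set δ := 1 / y ^ 2 + 8748 / y ^ 3 with hδ
  have hδ0 : 0 ≤ δ := by positivity
  have hup : B ≤ y * (1 + δ) := by
    have e : y * (1 + δ) = y + 1 / y + 8748 / y ^ 2 := by
      rw [hδ]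
      field_simp
      ring
    rw [e]; exact hhi
  constructor
  · have h3 : B ^ 3 ≤ (y * (1 + δ)) ^ 3 := pow_le_pow_left₀ hB0.le hup 3
    have hpos : 0 < (y * (1 + δ)) ^ 3 := by positivity
    have hbern : (1 - 3 * δ) * (1 + δ) ^ 3 ≤ 1 := by
      nlinarith [sq_nonneg δ, mul_nonneg hδ0 (sq_nonneg δ), pow_nonneg hδ0 4]
    calc (1 - 3 * δ) / y ^ 2 ≤ y / (y * (1 + δ)) ^ 3 := by
          rw [div_le_div_iff₀ (by positivity) hpos]
          nlinarith [hbern, pow_pos hy0 3]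
      _ ≤ y / B ^ 3 := div_le_div_of_nonneg_left hy0.le (pow_pos hB0 3) h3
  · have h3 : y ^ 3 ≤ B ^ 3 := pow_le_pow_left₀ hy0.le hlo 3
    calc y / B ^ 3 ≤ y / y ^ 3 := div_le_div_of_nonneg_left hy0.le (pow_pos hy0 3) h3
      _ = 1 / y ^ 2 := by rw [div_eq_div_iff (by positivity) (by positivity)]; ring

/-- ★★ **Scaled lower bound** on the whole regime: `2 − 6/y² − 52488/y³ ≤ y²(m(y) − 1)` (`y > μ⁴`).
[cite: MadrasSlade1993, §4.2, Theorem 4.2.2] [cite: BeatonBousquetMelouDeGierDuminilCopinGuttmann2014, §3.1, Proposition 5] -/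
theorem sq_mul_pwbMean_sub_one_ge (hy : hexConnectiveConstant ^ 4 < y) :
    2 - 6 / y ^ 2 - 52488 / y ^ 3 ≤ y ^ 2 * (pwbMean y - 1) := by
  have hy1 := one_le_of_mu_four_lt_el hy
  have hy0 : 0 < y := by linarith
  have hlow := (div_wallRate_six_window hy1).1
  have hm := two_mul_div_le_pwbMean_sub_one hy
  have h1 := mul_le_mul_of_nonneg_left hlow (by positivity : (0 : ℝ) ≤ y ^ 2)
  have h2 := mul_le_mul_of_nonneg_left hm (by positivity : (0 : ℝ) ≤ y ^ 2)
  have e1 : y ^ 2 * ((1 - 3 * (1 / y ^ 2 + 8748 / y ^ 3)) / y ^ 2) = 1 - 3 / y ^ 2 - 26244 / y ^ 3 := by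
    rw [mul_div_assoc', mul_div_cancel_left₀ _ (by positivity : y ^ 2 ≠ 0)]
    ring
  have e2 : y ^ 2 * (2 * y / wallRate y ^ 6) = 2 * (y ^ 2 * (y / wallRate y ^ 6)) := by ring
  have e3 : (2 : ℝ) - 6 / y ^ 2 - 52488 / y ^ 3 = 2 * (1 - 3 / y ^ 2 - 26244 / y ^ 3) := by ring
  rw [e1] at h1
  rw [e2] at h2
  rw [e3]
  linarith

/-- ★★ **Scaled upper bound** for `y ≥ 48`: `y²(m(y) − 1) ≤ 2 + 255879/y + 12 μ¹⁴/√y` (`#(ipwb n) ≤ 3ⁿ`, `3·3⁸ + 4·3¹⁰ = 255879`).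
[cite: MadrasSlade1993, §1.2, (1.2.3) and §4.2, Theorem 4.2.2] [cite: Kesten1963SAW, §4] -/
theorem sq_mul_pwbMean_sub_one_le (hy : 48 ≤ y) :
    y ^ 2 * (pwbMean y - 1) ≤ 2 + 255879 / y + 12 * hexConnectiveConstant ^ 14 / Real.sqrt y := by
  have hy1 : 1 ≤ y := by linarith
  have hy0 : 0 < y := by linarith
  have hs0 : 0 < Real.sqrt y := Real.sqrt_pos.2 hy0
  obtain ⟨m, hm⟩ : ∃ m : ℕ, m = 8 := ⟨8, rfl⟩
  obtain ⟨m', hm'⟩ : ∃ m' : ℕ, m' = 10 := ⟨10, rfl⟩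
  have hup := (div_wallRate_six_window hy1).2
  have hmean := pwbMean_sub_one_le_census hm hm' hy
  have h8 := card_ipwb_le_three_pow m
  have h10 := card_ipwb_le_three_pow m'
  have e8 : (3 : ℝ) ^ m = 6561 := by rw [hm]; norm_num
  have e10 : (3 : ℝ) ^ m' = 59049 := by rw [hm']; norm_num
  rw [e8] at h8
  rw [e10] at h10
  have hN : (3 * #(ipwb m) + 4 * #(ipwb m') : ℝ) ≤ 255879 := by linarith
  have hA : y ^ 2 * (y / wallRate y ^ 6) ≤ 1 := by
    have h := mul_le_mul_of_nonneg_left hup (by positivity : (0 : ℝ) ≤ y ^ 2)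
    rwa [mul_one_div, div_self (by positivity : y ^ 2 ≠ 0)] at h
  have hB : y ^ 2 * ((3 * #(ipwb m) + 4 * #(ipwb m')) / y ^ 3) ≤ 255879 / y := by
    have e : y ^ 2 * ((3 * #(ipwb m) + 4 * #(ipwb m') : ℝ) / y ^ 3) = (3 * #(ipwb m) + 4 * #(ipwb m')) / y := by
      rw [mul_div_assoc', div_eq_div_iff (by positivity) hy0.ne']
      ring
    rw [e]
    exact div_le_div_of_nonneg_right hN hy0.le
  have hC : y ^ 2 * (12 * hexConnectiveConstant ^ 14 / (y ^ 2 * Real.sqrt y)) =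
      12 * hexConnectiveConstant ^ 14 / Real.sqrt y := by
    rw [mul_div_assoc', div_eq_div_iff (by positivity) hs0.ne']
    ring
  have h := mul_le_mul_of_nonneg_left hmean (by positivity : (0 : ℝ) ≤ y ^ 2)
  have e2 : y ^ 2 * (2 * y / wallRate y ^ 6 + (3 * #(ipwb m) + 4 * #(ipwb m')) / y ^ 3 +
      12 * hexConnectiveConstant ^ 14 / (y ^ 2 * Real.sqrt y)) =
      2 * (y ^ 2 * (y / wallRate y ^ 6)) + y ^ 2 * ((3 * #(ipwb m) + 4 * #(ipwb m')) / y ^ 3) +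
        y ^ 2 * (12 * hexConnectiveConstant ^ 14 / (y ^ 2 * Real.sqrt y)) := by ring
  rw [e2, hC] at h
  linarith

/-- ★ **Explicit window**: for `y ≥ 48`, `|y²(m(y) − 1) − 2| ≤ 255879/y + 12μ¹⁴/√y + 6/y² + 52488/y³`.
[cite: MadrasSlade1993, §1.2, (1.2.3) and §4.2, Theorem 4.2.2] [cite: Kesten1963SAW, §4] -/
theorem abs_sq_mul_pwbMean_sub_one_sub_two_le (hy : 48 ≤ y) :
    |y ^ 2 * (pwbMean y - 1) - 2| ≤
      255879 / y + 12 * hexConnectiveConstant ^ 14 / Real.sqrt y + 6 / y ^ 2 + 52488 / y ^ 3 := by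
  have hy0 : 0 < y := by linarith
  have hμ : hexConnectiveConstant ^ 4 < y := mu_four_lt_twelve_el.trans_le (by linarith)
  have hlo := sq_mul_pwbMean_sub_one_ge hμ
  have hup := sq_mul_pwbMean_sub_one_le hy
  have hnn1 : 0 ≤ 12 * hexConnectiveConstant ^ 14 / Real.sqrt y := by positivity
  have hnn2 : (0 : ℝ) ≤ 255879 / y := by positivity
  have hnn3 : (0 : ℝ) ≤ 6 / y ^ 2 := by positivity
  have hnn4 : (0 : ℝ) ≤ 52488 / y ^ 3 := by positivity
  rw [abs_le]
  constructor <;> linarith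

/-- ★★★ **THE EXACT RENEWAL EXCESS**: `y²(m(y) − 1) → 2` as `y → ∞` — asymptotically all of the excess of the mean block
half-length over the atom is carried by the dip. NEW. [cite: MadrasSlade1993, §4.2, Theorem 4.2.2 (pp. 91–92)]
[cite: Kesten1963SAW, §4] [cite: JansevanRensburgWhittington2013, §3.1 (strong-adsorption expansions)] -/
theorem tendsto_sq_mul_pwbMean_sub_one : Tendsto (fun y : ℝ => y ^ 2 * (pwbMean y - 1)) atTop (𝓝 2) := by
  have h1 : Tendsto (fun y : ℝ => (255879 : ℝ) / y) atTop (𝓝 0) := tendsto_const_nhds.div_atTop tendsto_id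
  have h2 : Tendsto (fun y : ℝ => 12 * hexConnectiveConstant ^ 14 / Real.sqrt y) atTop (𝓝 0) :=
    tendsto_const_nhds.div_atTop Real.tendsto_sqrt_atTop
  have h3 : Tendsto (fun y : ℝ => (6 : ℝ) / y ^ 2) atTop (𝓝 0) :=
    tendsto_const_nhds.div_atTop (tendsto_pow_atTop two_ne_zero)
  have h4 : Tendsto (fun y : ℝ => (52488 : ℝ) / y ^ 3) atTop (𝓝 0) :=
    tendsto_const_nhds.div_atTop (tendsto_pow_atTop three_ne_zero)
  have hg0 : Tendsto (fun y : ℝ => 255879 / y + 12 * hexConnectiveConstant ^ 14 / Real.sqrt y + 6 / y ^ 2 + 52488 / y ^ 3)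
      atTop (𝓝 0) := by
    have h := ((h1.add h2).add h3).add h4
    simpa using h
  have hlo : Tendsto (fun y : ℝ => 2 - (255879 / y + 12 * hexConnectiveConstant ^ 14 / Real.sqrt y + 6 / y ^ 2 + 52488 / y ^ 3))
      atTop (𝓝 2) := by simpa using tendsto_const_nhds.sub hg0
  have hup : Tendsto (fun y : ℝ => 2 + (255879 / y + 12 * hexConnectiveConstant ^ 14 / Real.sqrt y + 6 / y ^ 2 + 52488 / y ^ 3))
      atTop (𝓝 2) := by simpa using tendsto_const_nhds.add hg0
  refine tendsto_of_tendsto_of_tendsto_of_le_of_le' hlo hup ?_ ?_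
  · filter_upwards [eventually_ge_atTop (48 : ℝ)] with y hy
    have h := (abs_le.1 (abs_sq_mul_pwbMean_sub_one_sub_two_le hy)).1
    linarith
  · filter_upwards [eventually_ge_atTop (48 : ℝ)] with y hy
    have h := (abs_le.1 (abs_sq_mul_pwbMean_sub_one_sub_two_le hy)).2
    linarith

/-- ★ **Asymptotic equivalence** `m(y) − 1 ∼ 2/y²` (`y → ∞`). [cite: MadrasSlade1993, §4.2, Theorem 4.2.2 (pp. 91–92)] [cite: Kesten1963SAW, §4] -/
theorem isEquivalent_pwbMean_sub_one : (fun y : ℝ => pwbMean y - 1) ~[atTop] fun y : ℝ => 2 / y ^ 2 := by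
  have hz : ∀ᶠ y : ℝ in atTop, (2 : ℝ) / y ^ 2 ≠ 0 := by
    filter_upwards [eventually_gt_atTop (0 : ℝ)] with y hy
    positivity
  refine (isEquivalent_iff_tendsto_one hz).2 ?_
  have h := tendsto_sq_mul_pwbMean_sub_one.div_const 2
  rw [show ((2 : ℝ) / 2) = 1 by norm_num] at h
  refine h.congr' ?_
  filter_upwards [eventually_gt_atTop (0 : ℝ)] with y hy
  simp only [Pi.div_apply]
  rw [div_div_eq_mul_div]
  ring

end Literature.Probability.RandomPlanarGeometry.SAW.HexBW.Wall
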